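import Literature.NumberTheory.Automorphic.HilbertRepSpectrumProofs
import Literature.NumberTheory.Automorphic.HilbertRepOrthogonalDecomposition
import Literature.NumberTheory.Automorphic.UnitaryIsotypicProjection
import HarnessLib

/-!
# Isotypic components of a unitary representation: orthogonality, stability under the
# commutant, and stability of closed invariant subspaces under the isotypic projections
(Deitmar–Echterhoff, *Principles of Harmonic Analysis* (2014), Cor. 6.1.9 and §7.3 (isotypes,
Thm. 7.3.2); Dixmier, *C\*-algebras* (1977), §5.4 and §13.1)

Topic `NumberTheory/Automorphic`; theorems and two definitions, no named fact, no instance,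
extending the vocabulary of `HilbertRepSpectrum` (`ClosedSubrep`, `ClosedSubrep.iSupClosure`,
`IsTopIrreducible`, `AreUnitarilyEquivalent`, `IsUnitary`, `discretePart`) for a unitary
representation `π` of a group `G` on a complex Hilbert space `H`.

For a representation `σ` of `G` on another Hilbert space `H'` (in practice irreducible) the
*`σ`-isotypic component* of `π` is the closed span of the topologically irreducible closed
subrepresentations of `π` unitarily equivalent to `σ` — Deitmar–Echterhoff's *isotype*
`V_π(τ) = Σ_{U ≅ V_τ} U` (§7.3, stated there for compact groups, where the sum is automatically
closed, Thm. 7.3.2 (a)), taken with a closure so that it is a `ClosedSubrep` for every `G`.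
This file proves, for unitary `π`:

* `isotypicComponent_congr` — the component depends on `σ` only up to unitary equivalence;
  `le_isotypicComponent`, `isotypicComponent_le_discretePart`.
* `isotypicComponent_le_orthogonal`, `isOrtho_isotypicComponent` — **components of inequivalent
  classes are orthogonal** (from the tree's
  `ClosedSubrep.isOrtho_of_not_areUnitarilyEquivalent`, Deitmar–Echterhoff Cor. 6.1.9).
* `apply_mem_isotypicComponent_of_commute` — **stability under the commutant**: a bounded
  operator `A` commuting with every `π g` maps each isotypic component into itself. Proof: on an
  irreducible member `W ≃ σ` the intertwiner `A|_W` satisfies `‖A v‖ = r ‖v‖`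
  (`IsTopIrreducible.exists_norm_map_eq_mul`, Cor. 6.1.9); if `r = 0` it vanishes, otherwise
  `r⁻¹ A|_W` is an isometric intertwiner whose range is a closed subrepresentation
  (`ClosedSubrep.ofLinearIsometry`) equivalent to `W` (`ClosedSubrep.equivOfLinearIsometry`),
  hence irreducible (`isTopIrreducible_congr`) and again a member; continuity passes to the
  closed span.
* `starProjection_isotypicComponent_mem` — **the orthogonal projection onto an isotypic
  component maps every closed invariant subspace `M` into itself**: the projection `P_M`
  commutes with `π` (`IsUnitary.starProjection_map_eq` of `UnitaryIsotypicProjection`), so it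
  preserves the component `N` and — being self-adjoint — also `Nᗮ`; hence for `v ∈ M` the
  decomposition `v = P_M (P_N v) + P_M (v - P_N v)` is the orthogonal decomposition along
  `N ⊕ Nᗮ`, i.e. `P_N v = P_M (P_N v) ∈ M`. (For compact groups this is the statement that the
  isotypic projector `dim τ ∫ conj χ_τ(k) π(k) dk` of Deitmar–Echterhoff Prop. 7.3.3 lies in the von
  Neumann algebra generated by `π(G)`; no Haar measure is used here.)
* Two adapters for consumers holding unbundled data: `isUnitary_iff_inner_map_map`
  (`π.IsUnitary ↔ ∀ g x y, ⟪π g x, π g y⟫ = ⟪x, y⟫` for a *group* `G`) and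
  `ClosedSubrep.ofSubmodule` (a closed submodule stable under every `π g` as a `ClosedSubrep`).

## Mathlib

Mathlib (pinned) has `ContRepresentation`, `Subrepresentation`, `unitary`, orthogonal
projections `Submodule.starProjection` with `Submodule.eq_starProjection_of_mem_orthogonal`,
`Submodule.inner_starProjection_left_eq_right`, and `Submodule.isOrtho_iSup_left/right`; it has
no isotypic components of Hilbert-space representations (its `isotypicComponent`s are for
semisimple modules). Everything below is a thin layer over the tree files imported above.

## Design notes

* As in `HilbertRepSpectrum`, the new declarations live in `namespace ContRepresentation`
  (`π.isotypicMembers σ`, `π.isotypicComponent σ`, `ClosedSubrep.ofSubmodule`) as DELIBERATE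
  dot-notation extensions of Mathlib's `ContRepresentation`; nothing else is declared into a
  Mathlib namespace.
* `σ` is not required to be irreducible in the definitions: for non-irreducible `σ` the set of
  members is empty and the component is `⊥`; the lemmas hold regardless.
* Provenance. The statements are the generic (representation-theoretic) layer that the
  adjudication package of the 2001 Hodge/CM manuscripts (`HodgeCM.RepDecomp`, file
  `Automorphic/IsotypicDecomposition.lean` §§3–5 there) had rebuilt over bare monoid
  homomorphisms `G →* (H →L[ℂ] H)`; they are re-proved here over the tree's vocabulary so that
  the package's problem-specific files can import the tree instead. Nothing in this file is a
  claim of those manuscripts: every statement is standard unitary representation theory with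
  the citations given.
* Not here: the decomposition `H = ⊕̂_σ H_σ` for discretely decomposable `π` (it follows from
  `IsUnitary.exists_orthogonalDecomposition` of `HilbertRepOrthogonalDecomposition` and is not
  needed by the consumers), and multiplicities (see `multiplicity`, `FiniteMultiplicityCriterion`).

## References

* A. Deitmar, S. Echterhoff, *Principles of Harmonic Analysis*, 2nd ed., Universitext, Springer
  (2014): Lemma 6.1.7 and Cor. 6.1.9 (PDF p. 175), §7.3 *Isotypes*, Thm. 7.3.2, Prop. 7.3.3
  (printed pp. 142–143) [DeitmarEchterhoff2014].
* J. Dixmier, *C\*-algebras*, North-Holland (1977), §5.4 and §13.1 [Dixmier1977].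
-/

noncomputable section

open scoped InnerProductSpace
open Topology

namespace ContRepresentation

section Hilbert

variable {G H H' H'' : Type*} [Group G]
  [NormedAddCommGroup H] [InnerProductSpace ℂ H] [CompleteSpace H]
  [NormedAddCommGroup H'] [InnerProductSpace ℂ H'] [CompleteSpace H']
  [NormedAddCommGroup H''] [InnerProductSpace ℂ H''] [CompleteSpace H'']

/-! ### Adapters for unbundled data -/

omit [CompleteSpace H] in
/-- For a *group* `G`, `π` is unitary iff every `π g` preserves inner products: `→` is
`IsUnitary.inner_map_map`; for `←`, each `π g` is an isometry (`‖π g x‖² = ⟪π g x, π g x⟫ = ‖x‖²`)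
and invertible (`g` is a unit), hence unitary (Mathlib `IsUnit.mem_unitary_of_star_mul_self`,
`ContinuousLinearMap.norm_map_iff_adjoint_comp_self`). Deitmar–Echterhoff (2014), §6.1
(definition of a unitary representation). [folklore] -/
theorem isUnitary_iff_inner_map_map [CompleteSpace H] {π : ContRepresentation ℂ G H} :
    π.IsUnitary ↔ ∀ (g : G) (x y : H), ⟪π g x, π g y⟫_ℂ = ⟪x, y⟫_ℂ := by
  refine ⟨fun hπ g x y => hπ.inner_map_map g x y, fun h g => ?_⟩
  have hu : IsUnit (π g) := (Group.isUnit g).map π.toMonoidHom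
  refine hu.mem_unitary_of_star_mul_self ((π g).norm_map_iff_adjoint_comp_self.mp fun x => ?_)
  rw [norm_eq_sqrt_re_inner (𝕜 := ℂ), norm_eq_sqrt_re_inner (𝕜 := ℂ) x, h g x x]

omit [CompleteSpace H] in
/-- A closed submodule of `H` stable under every `π g`, packaged as a closed subrepresentation
(Dixmier (1977), §13.1.2). [cite: Dixmier1977, §13.1.2] -/
def ClosedSubrep.ofSubmodule {π : ContRepresentation ℂ G H} (V : Submodule ℂ H)
    (hVc : IsClosed (V : Set H)) (hV : ∀ (g : G), ∀ v ∈ V, π g v ∈ V) : ClosedSubrep π where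
  toSubmodule := V
  apply_mem_toSubmodule g v hv := hV g v hv
  isClosed' := hVc

omit [CompleteSpace H] in
/-- The submodule underlying `ClosedSubrep.ofSubmodule V _ _` is `V`. [folklore] -/
@[simp]
theorem ClosedSubrep.toSubmodule_ofSubmodule {π : ContRepresentation ℂ G H} (V : Submodule ℂ H)
    (hVc : IsClosed (V : Set H)) (hV : ∀ (g : G), ∀ v ∈ V, π g v ∈ V) :
    (ClosedSubrep.ofSubmodule V hVc hV).toSubmodule = V := rfl

omit [CompleteSpace H] in
/-- Membership in `ClosedSubrep.ofSubmodule V _ _` is membership in `V`. [folklore] -/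
@[simp]
theorem ClosedSubrep.mem_ofSubmodule {π : ContRepresentation ℂ G H} (V : Submodule ℂ H)
    (hVc : IsClosed (V : Set H)) (hV : ∀ (g : G), ∀ v ∈ V, π g v ∈ V) (x : H) :
    x ∈ ClosedSubrep.ofSubmodule V hVc hV ↔ x ∈ V := Iff.rfl

/-! ### The isotypic component -/

variable (π : ContRepresentation ℂ G H) (σ : ContRepresentation ℂ G H')

/-- The *members of the class of `σ`* in `π`: the topologically irreducible closed
subrepresentations of `π` unitarily equivalent to `σ` (Deitmar–Echterhoff (2014), §7.3: "all
invariant subspaces `U` which are isomorphic to `V_τ`"). [cite: DeitmarEchterhoff2014, §7.3] -/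
def isotypicMembers : Set (ClosedSubrep π) :=
  {W | W.toContRep.IsTopIrreducible ∧ AreUnitarilyEquivalent W.toContRep σ}

/-- The *`σ`-isotypic component* of `π`: the closed span of the irreducible closed
subrepresentations of `π` unitarily equivalent to `σ` (Deitmar–Echterhoff (2014), §7.3,
`V_π(τ) = Σ_{U ≅ V_τ} U`, with a closure; Dixmier (1977), §5.4). [cite: DeitmarEchterhoff2014, §7.3] -/
def isotypicComponent : ClosedSubrep π :=
  ClosedSubrep.iSupClosure (π.isotypicMembers σ)

variable {π σ}

omit [CompleteSpace H] [CompleteSpace H'] in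
/-- Unfolding membership in `isotypicMembers`. [folklore] -/
theorem mem_isotypicMembers_iff {W : ClosedSubrep π} :
    W ∈ π.isotypicMembers σ ↔
      W.toContRep.IsTopIrreducible ∧ AreUnitarilyEquivalent W.toContRep σ :=
  Iff.rfl

omit [CompleteSpace H] [CompleteSpace H'] in
/-- The submodule underlying the isotypic component is the closure of the algebraic sum of the
members (Deitmar–Echterhoff (2014), §7.3). [cite: DeitmarEchterhoff2014, §7.3] -/
theorem toSubmodule_isotypicComponent :
    (π.isotypicComponent σ).toSubmodule =
      (⨆ W ∈ π.isotypicMembers σ, (W : ClosedSubrep π).toSubmodule).topologicalClosure :=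
  rfl

omit [CompleteSpace H] [CompleteSpace H'] in
/-- An irreducible closed subrepresentation equivalent to `σ` lies in the `σ`-isotypic component
(Deitmar–Echterhoff (2014), §7.3). [cite: DeitmarEchterhoff2014, §7.3] -/
theorem le_isotypicComponent {W : ClosedSubrep π} (hW : W.toContRep.IsTopIrreducible)
    (he : AreUnitarilyEquivalent W.toContRep σ) : W ≤ π.isotypicComponent σ :=
  ClosedSubrep.le_iSupClosure ⟨hW, he⟩

omit [CompleteSpace H] [CompleteSpace H'] in
/-- The isotypic component is below every closed subrepresentation containing all members
(Dixmier (1977), §13.1.2). [cite: Dixmier1977, §13.1.2] -/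
theorem isotypicComponent_le {Z : ClosedSubrep π}
    (h : ∀ W : ClosedSubrep π, W.toContRep.IsTopIrreducible →
      AreUnitarilyEquivalent W.toContRep σ → W ≤ Z) :
    π.isotypicComponent σ ≤ Z :=
  ClosedSubrep.iSupClosure_le fun W hW => h W hW.1 hW.2

omit [CompleteSpace H] [CompleteSpace H'] in
/-- Every isotypic component lies in the discrete part `π_disc` (the closed span of all
irreducible closed subrepresentations; Dixmier (1977), §5.4). [cite: Dixmier1977, §5.4] -/
theorem isotypicComponent_le_discretePart : π.isotypicComponent σ ≤ π.discretePart :=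
  isotypicComponent_le fun _ hW _ => le_discretePart hW

omit [CompleteSpace H] [CompleteSpace H'] [CompleteSpace H''] in
/-- The members of the class of `σ` depend on `σ` only up to unitary equivalence. [folklore] -/
theorem isotypicMembers_congr {σ' : ContRepresentation ℂ G H''} (h : AreUnitarilyEquivalent σ σ') :
    π.isotypicMembers σ = π.isotypicMembers σ' := by
  ext W
  exact ⟨fun hW => ⟨hW.1, hW.2.trans h⟩, fun hW => ⟨hW.1, hW.2.trans h.symm⟩⟩

omit [CompleteSpace H] [CompleteSpace H'] [CompleteSpace H''] in
/-- The isotypic component depends on `σ` only up to unitary equivalence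
(Deitmar–Echterhoff (2014), §7.3: it is indexed by the class `τ ∈ Ĝ`). [cite: DeitmarEchterhoff2014, §7.3] -/
theorem isotypicComponent_congr {σ' : ContRepresentation ℂ G H''}
    (h : AreUnitarilyEquivalent σ σ') : π.isotypicComponent σ = π.isotypicComponent σ' := by
  rw [isotypicComponent, isotypicComponent, isotypicMembers_congr h]

/-! ### Orthogonality of inequivalent components -/

omit [CompleteSpace H'] [CompleteSpace H''] in
/-- **Isotypic components of inequivalent classes are orthogonal**, in the form
`H_σ ≤ (H_{σ'})ᗮ`: a member `W ≃ σ` and a member `W' ≃ σ'` cannot be equivalent (else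
`σ ≃ W ≃ W' ≃ σ'`), so `W ⟂ W'` (`ClosedSubrep.isOrtho_of_not_areUnitarilyEquivalent`,
Deitmar–Echterhoff (2014), Cor. 6.1.9); orthogonality passes to sums and closures
(Deitmar–Echterhoff (2014), Thm. 7.3.2 (c); Dixmier (1977), §5.4). [cite: DeitmarEchterhoff2014, Cor. 6.1.9] -/
theorem isotypicComponent_le_orthogonal (hπ : π.IsUnitary) {σ' : ContRepresentation ℂ G H''}
    (hne : ¬ AreUnitarilyEquivalent σ σ') :
    π.isotypicComponent σ ≤ (π.isotypicComponent σ').orthogonal hπ := by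
  -- every member of the class of `σ` is orthogonal to every member of the class of `σ'`
  have hmem : ∀ W ∈ π.isotypicMembers σ, ∀ W' ∈ π.isotypicMembers σ',
      W.toSubmodule ⟂ W'.toSubmodule := by
    intro W hW W' hW'
    refine ClosedSubrep.isOrtho_of_not_areUnitarilyEquivalent hπ hW.1 hW'.1 fun hWW' => hne ?_
    exact (hW.2.symm.trans hWW').trans hW'.2
  -- hence the algebraic sums are orthogonal
  have hsum : (⨆ W ∈ π.isotypicMembers σ, (W : ClosedSubrep π).toSubmodule) ⟂
      (⨆ W' ∈ π.isotypicMembers σ', (W' : ClosedSubrep π).toSubmodule) := by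
    refine Submodule.isOrtho_iSup_left.mpr fun W => Submodule.isOrtho_iSup_left.mpr fun hW => ?_
    exact Submodule.isOrtho_iSup_right.mpr fun W' => Submodule.isOrtho_iSup_right.mpr fun hW' =>
      hmem W hW W' hW'
  -- and so are their closures: `closure A ≤ Bᗮ` and `B ≤ (closure A)ᗮ`, both sides closed
  intro v hv
  set A := ⨆ W ∈ π.isotypicMembers σ, (W : ClosedSubrep π).toSubmodule with hA
  set B := ⨆ W' ∈ π.isotypicMembers σ', (W' : ClosedSubrep π).toSubmodule with hB
  change v ∈ A.topologicalClosure at hv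
  change v ∈ B.topologicalClosureᗮ
  have h1 : A.topologicalClosure ≤ Bᗮ :=
    A.topologicalClosure_minimal hsum.le (Submodule.isClosed_orthogonal B)
  have h2 : B ≤ A.topologicalClosureᗮ := (Submodule.isOrtho_comm.mp h1).le
  have h3 : B.topologicalClosure ≤ A.topologicalClosureᗮ :=
    B.topologicalClosure_minimal h2 (Submodule.isClosed_orthogonal _)
  exact (Submodule.isOrtho_comm.mp (h3 : B.topologicalClosure ⟂ A.topologicalClosure)) hv

omit [CompleteSpace H'] [CompleteSpace H''] in
/-- **Isotypic components of inequivalent classes are orthogonal** (Deitmar–Echterhoff (2014),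
Thm. 7.3.2 (c) with Cor. 6.1.9; Dixmier (1977), §5.4). [cite: DeitmarEchterhoff2014, Thm. 7.3.2] -/
theorem isOrtho_isotypicComponent (hπ : π.IsUnitary) {σ' : ContRepresentation ℂ G H''}
    (hne : ¬ AreUnitarilyEquivalent σ σ') :
    (π.isotypicComponent σ).toSubmodule ⟂ (π.isotypicComponent σ').toSubmodule :=
  ClosedSubrep.isOrtho_of_le_orthogonal hπ (isotypicComponent_le_orthogonal hπ hne)

/-! ### Stability under the commutant of `π(G)` -/

omit [CompleteSpace H'] in
/-- **An operator commuting with `π(G)` maps every irreducible member `W ≃ σ` into the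
`σ`-isotypic component.** `A|_W : W → H` is an intertwiner out of an irreducible unitary
representation, so `‖A v‖ = r ‖v‖` on `W` (Deitmar–Echterhoff (2014), Cor. 6.1.9, in the tree as
`IsTopIrreducible.exists_norm_map_eq_mul`); if `r = 0` then `A|_W = 0`, otherwise `r⁻¹ A|_W` is
an isometric intertwiner and its range is an irreducible closed subrepresentation equivalent to
`W`, hence to `σ`. [cite: DeitmarEchterhoff2014, Cor. 6.1.9] -/
theorem apply_mem_isotypicComponent_of_mem_members (hπ : π.IsUnitary) {A : H →L[ℂ] H}
    (hA : ∀ g : G, A ∘L π g = π g ∘L A) {W : ClosedSubrep π} (hW : W ∈ π.isotypicMembers σ)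
    {v : H} (hv : v ∈ W) : A v ∈ π.isotypicComponent σ := by
  -- the intertwiner `T = A|_W : W → H`
  set T : W.toSubmodule →L[ℂ] H := A ∘L W.toSubmodule.subtypeL with hTdef
  have hTapply : ∀ w : W.toSubmodule, T w = A (w : H) := fun w => rfl
  have hT : ∀ g : G, T ∘L W.toContRep g = π g ∘L T := by
    intro g
    apply ContinuousLinearMap.ext
    intro w
    change A (π g (w : H)) = π g (A (w : H))
    exact congrArg (fun S : H →L[ℂ] H => S (w : H)) (hA g)
  obtain ⟨r, hr0, hr⟩ := hW.1.exists_norm_map_eq_mul (hπ.toContRep W) hπ hT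
  rcases hr0.eq_or_lt with h0 | hrpos
  · -- `r = 0`: `A` vanishes on `W`
    have hAv : A v = 0 := by
      rw [← hTapply ⟨v, hv⟩, ← norm_eq_zero, hr, ← h0, zero_mul]
    rw [hAv]
    exact (π.isotypicComponent σ).toSubmodule.zero_mem
  · -- `r > 0`: `U = r⁻¹ T` is an isometric intertwiner
    let U : W.toSubmodule →ₗᵢ[ℂ] H :=
      { toLinearMap := ((r⁻¹ : ℝ) : ℂ) • (T : W.toSubmodule →ₗ[ℂ] H)
        norm_map' := fun w => by
          change ‖((r⁻¹ : ℝ) : ℂ) • T w‖ = ‖w‖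
          rw [norm_smul, Complex.norm_real, Real.norm_eq_abs, abs_of_nonneg (inv_nonneg.mpr hr0),
            hr w, ← mul_assoc, inv_mul_cancel₀ hrpos.ne', one_mul] }
    have hUapply : ∀ w : W.toSubmodule, U w = ((r⁻¹ : ℝ) : ℂ) • T w := fun w => rfl
    have hU : ∀ (g : G) (w : W.toSubmodule), U (W.toContRep g w) = π g (U w) := by
      intro g w
      have h := congrArg (fun f : W.toSubmodule →L[ℂ] H => f w) (hT g)
      simp only [ContinuousLinearMap.coe_comp, Function.comp_apply] at h
      rw [hUapply, hUapply, h, map_smul]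
    -- its range `W''` is a member of the class of `σ`
    set W'' : ClosedSubrep π := ClosedSubrep.ofLinearIsometry U hU with hW''
    have hWeq : AreUnitarilyEquivalent W.toContRep W''.toContRep := by
      refine ⟨ClosedSubrep.equivOfLinearIsometry U hU, ?_⟩
      refine AddMonoidHomClass.isometry_of_norm _ fun w => ?_
      rw [← U.norm_map w]
      rfl
    have hirr : W''.toContRep.IsTopIrreducible := by
      obtain ⟨e, -⟩ := hWeq
      exact (isTopIrreducible_congr e).mp hW.1
    have hW''mem : W'' ∈ π.isotypicMembers σ := ⟨hirr, hWeq.symm.trans hW.2⟩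
    -- and `A v = r • U v ∈ W''`
    have hAv : A v = (r : ℂ) • U ⟨v, hv⟩ := by
      rw [hUapply, hTapply, smul_smul, ← Complex.ofReal_mul, mul_inv_cancel₀ hrpos.ne',
        Complex.ofReal_one, one_smul]
    rw [hAv]
    refine (π.isotypicComponent σ).toSubmodule.smul_mem _ ?_
    exact le_isotypicComponent hW''mem.1 hW''mem.2 ((ClosedSubrep.mem_ofLinearIsometry U hU _).mpr
      ⟨⟨v, hv⟩, rfl⟩)

omit [CompleteSpace H'] in
/-- **Isotypic components are stable under the commutant of `π(G)`**: a bounded operator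
commuting with every `π g` maps `H_σ` into itself (member by member by
`apply_mem_isotypicComponent_of_mem_members`, then by linearity and continuity on the closed
span). For compact groups this is contained in Deitmar–Echterhoff (2014), Prop. 7.3.3 (the
isotypic projector is `dim τ ∫ conj χ_τ(k) π(k) dk`); Dixmier (1977), §5.4. [cite: DeitmarEchterhoff2014, Prop. 7.3.3] -/
theorem apply_mem_isotypicComponent_of_commute (hπ : π.IsUnitary) {A : H →L[ℂ] H}
    (hA : ∀ g : G, A ∘L π g = π g ∘L A) {v : H} (hv : v ∈ π.isotypicComponent σ) :
    A v ∈ π.isotypicComponent σ := by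
  set N := π.isotypicComponent σ with hN
  set M : Submodule ℂ H := ⨆ W ∈ π.isotypicMembers σ, (W : ClosedSubrep π).toSubmodule with hM
  -- the algebraic sum is mapped into `N`
  have hMle : M ≤ N.toSubmodule.comap (A : H →ₗ[ℂ] H) := by
    refine iSup₂_le fun W hW w hw => ?_
    exact apply_mem_isotypicComponent_of_mem_members hπ hA hW hw
  -- pass to the closure by continuity of `A`
  have hv' : v ∈ M.topologicalClosure := hv
  have hmaps : Set.MapsTo A (M : Set H) (N : Set H) := fun x hx => hMle hx
  have hcl := hmaps.closure A.continuous
  rw [← Submodule.topologicalClosure_coe] at hcl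
  have hAv : A v ∈ closure (N : Set H) := hcl hv'
  rwa [N.isClosed.closure_eq] at hAv

/-! ### The isotypic projections preserve closed invariant subspaces -/

omit [CompleteSpace H'] in
/-- **The orthogonal projection onto an isotypic component maps every closed invariant subspace
into itself.** For a closed subrepresentation `M`, the projection `P_M` commutes with `π`
(`IsUnitary.starProjection_map_eq`), hence maps the component `N = H_σ` into itself
(`apply_mem_isotypicComponent_of_commute`) and, being self-adjoint, also `Nᗮ` into itself; so for
`v ∈ M` the identity `v = P_M v = P_M (P_N v) + P_M (v - P_N v)` is the decomposition of `v` along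
`N ⊕ Nᗮ`, whence `P_N v = P_M (P_N v) ∈ M`. (Compact case: Deitmar–Echterhoff (2014),
Prop. 7.3.3 — the isotypic projector is a strong integral of the operators `π(k)`; general case:
Dixmier (1977), §5.4, the isotypic projections are central in the von Neumann algebra of `π`.)
[cite: DeitmarEchterhoff2014, Prop. 7.3.3] -/
theorem starProjection_isotypicComponent_mem (hπ : π.IsUnitary) (M : ClosedSubrep π) {v : H}
    (hv : v ∈ M) : (π.isotypicComponent σ).toSubmodule.starProjection v ∈ M := by
  set N : Submodule ℂ H := (π.isotypicComponent σ).toSubmodule with hN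
  -- `P_M` commutes with `π`, as an operator identity
  have hPM : ∀ g : G, M.toSubmodule.starProjection ∘L π g = π g ∘L M.toSubmodule.starProjection := by
    intro g
    apply ContinuousLinearMap.ext
    intro x
    exact hπ.starProjection_map_eq (fun k w hw => M.apply_mem k hw) g x
  -- hence `P_M` preserves `N` …
  have hPMN : ∀ x ∈ N, M.toSubmodule.starProjection x ∈ N := fun x hx =>
    apply_mem_isotypicComponent_of_commute hπ hPM hx
  -- … and `Nᗮ` (self-adjointness of `P_M`)
  have hPMN' : ∀ x ∈ Nᗮ, M.toSubmodule.starProjection x ∈ Nᗮ := by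
    intro x hx
    rw [Submodule.mem_orthogonal] at hx ⊢
    intro y hy
    rw [← Submodule.inner_starProjection_left_eq_right]
    exact hx _ (hPMN y hy)
  -- the decomposition of `v = P_M v` along `N ⊕ Nᗮ`
  have hvM : M.toSubmodule.starProjection v = v := Submodule.starProjection_eq_self_iff.mpr hv
  have key : N.starProjection v = M.toSubmodule.starProjection (N.starProjection v) := by
    refine Submodule.eq_starProjection_of_mem_orthogonal (hPMN _ (N.starProjection_apply_mem v)) ?_
    have h2 : v - M.toSubmodule.starProjection (N.starProjection v) =
        M.toSubmodule.starProjection (v - N.starProjection v) := by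
      rw [map_sub, hvM]
    rw [h2]
    exact hPMN' _ (N.sub_starProjection_mem_orthogonal v)
  rw [key]
  exact M.toSubmodule.starProjection_apply_mem _

omit [CompleteSpace H'] in
/-- `Submodule`-level form of `starProjection_isotypicComponent_mem` for consumers holding an
unbundled closed invariant subspace. [folklore] -/
theorem starProjection_isotypicComponent_mem' (hπ : π.IsUnitary) {V : Submodule ℂ H}
    (hVc : IsClosed (V : Set H)) (hV : ∀ (g : G), ∀ v ∈ V, π g v ∈ V) {v : H} (hv : v ∈ V) :
    (π.isotypicComponent σ).toSubmodule.starProjection v ∈ V :=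
  starProjection_isotypicComponent_mem hπ (ClosedSubrep.ofSubmodule V hVc hV) hv

end Hilbert

end ContRepresentation
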